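import Literature.Topology.FourManifolds.ConcordanceStripTube
import HarnessLib

/-!
# The tube of a strip of a conical concordance: framing, injectivity, separation

Topic `Literature/Topology/FourManifolds`; sequel of `ConcordanceStripTube.lean` in the
decomposition of the Fox–Milnor congruence
`Literature.Topology.FourManifolds.Knot.IsConnectedSum.isConcordant` (`BandSumConcordanceCore.lean`:
it remains to prove `Knot.exists_isConnectedSum_isConcordant_left`, "a small copy of the second
factor carried along a concordance of the first factor"). Here the abstract tube of
`StripFrame.TubeSetup` is attached to an actual concordance and all the point-set estimates the
carrying construction needs are proved:

* `Literature.Topology.FourManifolds.Knot.IsConicalConcordance K K' f δ` — a concordance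
  (`Knot.IsConcordance`) which is the cone `t • K x` for all `t ≤ 1 + δ` and `t • K' x` for all
  `t ≥ 2 - δ` (`0 < δ ≤ 1/4`); every concordance has such a representative
  (`Knot.IsConcordance.exists_conical`, `ConcordanceStraighteningBoth.lean`). Its tube setup
  `IsConicalConcordance.setup w` (lift `StripFrame.annulusLift f`, end curves `K.curve`,
  `K'.curve`).
* `IsConicalConcordance.injective_fderiv_annulusLift` — the lift is an immersion on the thickened
  annulus `1 - δ/2 ≤ t ≤ 2 + δ/2` (cones over immersed circles, `StripFrame.injective_coneL`);
  `exists_framed_strip` — general position (`StripFrame.exists_frame_strip`) frames a strip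
  `[θ₀ - η, θ₀ + η] × [1 - δ/2, 2 + δ/2]`, `0 < η ≤ 1/4`; `injOn_F_strip`, `exists_int_of_F_eq` —
  the lift identifies exactly the `ℤ`-translates in `θ` over the annulus.
* `Literature.Topology.FourManifolds.StripFrame.TubeSetup.GoodTube S θ₀ η ε` and
  **`IsConicalConcordance.exists_goodTube`**: along every arc `θ = θ₀` some setup of the
  concordance has a tube of angular half-width `η` and radius `ε ≤ 1` which is framed on the
  thickened strip, injective with injective derivative on (strip over `1 ≤ t ≤ 2`) `× B(0, ε)`
  (`TubeSetup.exists_injOn_tube`), **separated** — a tube point over the core strip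
  (half-width `η/4`) equals a point `F (θ', t')` of the annulus (`t' ∈ [1, 2]`) only on the zero
  section (`d = 0`, `t' = t`, `θ' ≡ θ mod ℤ`): the near sheet by injectivity of the tube, the sheet
  one period away being a positive distance off the core (`exists_sep_radius`) while the tube is
  uniformly close to the annulus (`TubeSetup.exists_forall_dist_tube_lt`) — and inside the open
  shell `1 < ‖y‖ < 2` over the open annulus (exactly level `t` near the ends by
  `TubeSetup.norm_tube_of_le/ge`, and within the margin `exists_shell_margin` in the middle).

A curve modified inside such a tube (the sequel) is therefore again an embedded, neat annulus in
the shell, i.e. a concordance between the modified end knots.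

## References

* M. W. Hirsch, *Differential Topology*, GTM 33, Springer (1976), Ch. 4 §5 (tubular
  neighbourhoods; Ex. 5: an injective immersion is injective near a compact set). [HirschDT1976]
* R. H. Fox, J. W. Milnor, *Singularities of 2-spheres in 4-space and cobordism of knots*, Osaka
  J. Math. 3 (1966), §1 (the consumer). [FoxMilnor1966]

## Design notes

* `IsConicalConcordance` and `GoodTube` are `Prop`-valued hypothesis structures (the data they
  speak about — `f`, `δ`, `w`, `θ₀`, `η`, `ε` — stay explicit), as CONVENTIONS §9 recommends.
* Minimisation on compact sets is routed through the small lemmas `exists_isMinOn_dist`,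
  `exists_isMinOn_isMaxOn_norm` (abstract sets) and the values of an `IsMinOn` witness are
  extracted with `simp only [mem_setOf_eq]` — applying the witness directly to a membership
  proof in a concrete product of intervals sends `isDefEq` into a timeout.
* No named facts, no `sorry`. Notation `𝔼 n`, `𝕊 n` is local, byte-identical to `Knots.lean`.
-/

open scoped Manifold ContDiff Topology RealInnerProductSpace
open Function Set Metric

noncomputable section

namespace Literature.Topology.FourManifolds

/-- Local notation: `𝔼 n` is the model Euclidean space `EuclideanSpace ℝ (Fin n)`. -/
local notation "𝔼 " n:arg => EuclideanSpace ℝ (Fin n)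

/-- Local notation: `𝕊 n` is the unit sphere in `EuclideanSpace ℝ (Fin (n + 1))`. -/
local notation "𝕊 " n:arg => (Metric.sphere (0 : EuclideanSpace ℝ (Fin (n + 1))) 1)

namespace Knot

/-- A **conical concordance** from `K` to `K'` of width `δ`: a concordance (`Knot.IsConcordance`)
which is the cone `t • K x` for all `t ≤ 1 + δ` and the cone `t • K' x` for all `t ≥ 2 - δ`,
`0 < δ ≤ 1/4`. Every concordance can be replaced by a conical one
(`Knot.IsConcordance.exists_conical`, `ConcordanceStraighteningBoth.lean`). [folklore] -/
structure IsConicalConcordance (K K' : Knot) (f : (𝕊 1) × ℝ → 𝔼 4) (δ : ℝ) : Prop where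
  isConcordance : IsConcordance K K' f
  δ_pos : 0 < δ
  δ_le : δ ≤ 1 / 4
  cone₁ : ∀ (x : 𝕊 1) (t : ℝ), t ≤ 1 + δ → f (x, t) = t • ((K x : 𝕊 3) : 𝔼 4)
  cone₂ : ∀ (x : 𝕊 1) (t : ℝ), 2 - δ ≤ t → f (x, t) = t • ((K' x : 𝕊 3) : 𝔼 4)

namespace IsConicalConcordance

variable {K K' : Knot} {f : (𝕊 1) × ℝ → 𝔼 4} {δ : ℝ}

/-- **The tube setup of a conical concordance** with general-position vector `w`: the lifted
annulus `annulusLift f`, the unit curves `K.curve`, `K'.curve` of the end knots, the cones.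
[folklore] -/
def setup (h : IsConicalConcordance K K' f δ) (w : 𝔼 4) : StripFrame.TubeSetup where
  F := StripFrame.annulusLift f
  k₁ := K.curve
  k₂ := K'.curve
  w := w
  δ := δ
  contDiff_F := StripFrame.contDiff_annulusLift h.isConcordance.1
  contDiff_k₁ := K.contDiff_curve
  contDiff_k₂ := K'.contDiff_curve
  norm_k₁ := K.norm_curve
  norm_k₂ := K'.norm_curve
  δ_pos := h.δ_pos
  δ_le := h.δ_le
  cone₁ θ t ht := by rw [StripFrame.annulusLift_apply, h.cone₁ _ t ht, Knot.curve_apply]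
  cone₂ θ t ht := by rw [StripFrame.annulusLift_apply, h.cone₂ _ t ht, Knot.curve_apply]

/-- The annulus of the setup is the lift. [folklore] -/
@[simp] theorem setup_F (h : IsConicalConcordance K K' f δ) (w : 𝔼 4) :
    (h.setup w).F = StripFrame.annulusLift f := rfl
/-- The inner curve of the setup. [folklore] -/
@[simp] theorem setup_k₁ (h : IsConicalConcordance K K' f δ) (w : 𝔼 4) :
    (h.setup w).k₁ = K.curve := rfl
/-- The outer curve of the setup. [folklore] -/
@[simp] theorem setup_k₂ (h : IsConicalConcordance K K' f δ) (w : 𝔼 4) :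
    (h.setup w).k₂ = K'.curve := rfl
/-- The vector of the setup. [folklore] -/
@[simp] theorem setup_w (h : IsConicalConcordance K K' f δ) (w : 𝔼 4) : (h.setup w).w = w := rfl
/-- The width of the setup. [folklore] -/
@[simp] theorem setup_δ (h : IsConicalConcordance K K' f δ) (w : 𝔼 4) : (h.setup w).δ = δ := rfl

end IsConicalConcordance

end Knot

namespace StripFrame

/-! ### The cone over an immersed unit curve is an immersion -/

/-- For a unit curve with nonvanishing velocity, the derivative `coneL k q` of the cone
`(θ, t) ↦ t • k θ` is injective at every `q` with `t ≠ 0` (`k ⊥ k'`). [folklore] -/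
theorem injective_coneL {k : ℝ → 𝔼 4} (hk : Differentiable ℝ k) (hn : ∀ θ, ‖k θ‖ = 1)
    (hk' : ∀ θ, deriv k θ ≠ 0) {q : ℝ × ℝ} (ht : q.2 ≠ 0) : Injective (coneL k q) := by
  refine (injective_iff_map_eq_zero _).2 fun v hv ↦ ?_
  rw [coneL_apply] at hv
  have horth : ⟪k q.1, deriv k q.1⟫ = 0 := inner_deriv_eq_zero_of_norm_eq_one hk hn q.1
  -- pair with `k θ`: `v₂ = 0`
  have h2 : v.2 = 0 := by
    have := congrArg (fun z ↦ ⟪k q.1, z⟫) hv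
    simp only [inner_add_right, real_inner_smul_right, real_inner_self_eq_norm_sq, hn, one_pow,
      mul_one, horth, mul_zero, add_zero, inner_zero_right] at this
    exact this
  rw [h2, zero_smul, zero_add, smul_smul] at hv
  have h1 : v.1 * q.2 = 0 := by
    rcases smul_eq_zero.1 hv with h | h
    · exact h
    · exact absurd h (hk' q.1)
  exact Prod.ext ((mul_eq_zero.1 h1).resolve_right ht) h2

namespace TubeSetup

variable (S : TubeSetup)

/-- **The tube is uniformly close to the annulus near the zero section**: over a compact set of
base points, `dist (tube (q, d)) (F q) < ρ` for `‖d‖ < ε`. [folklore] -/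
theorem exists_forall_dist_tube_lt {T : Set (ℝ × ℝ)} (hT : IsCompact T) {ρ : ℝ} (hρ : 0 < ρ) :
    ∃ ε : ℝ, 0 < ε ∧ ∀ q ∈ T, ∀ d ∈ ball (0 : ℝ × ℝ) ε, dist (S.tube (q, d)) (S.F q) < ρ := by
  set U : Set ((ℝ × ℝ) × (ℝ × ℝ)) := {p | dist (S.tube p) (S.F p.1) < ρ} with hU
  have hUo : IsOpen U :=
    isOpen_lt (S.contDiff_tube.continuous.dist (S.contDiff_F.continuous.comp continuous_fst))
      continuous_const
  have hKU : T ×ˢ ({0} : Set (ℝ × ℝ)) ⊆ U := by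
    rintro ⟨q, d⟩ ⟨-, hd⟩
    rw [mem_singleton_iff] at hd
    subst hd
    show dist (S.tube (q, 0)) (S.F q) < ρ
    rw [S.tube_zero, dist_self]
    exact hρ
  obtain ⟨u, v, -, hv, hTu, h0v, huv⟩ :=
    generalized_tube_lemma hT isCompact_singleton hUo hKU
  obtain ⟨ε, hε, hball⟩ := Metric.isOpen_iff.1 hv 0 (h0v (mem_singleton 0))
  exact ⟨ε, hε, fun q hq d hd ↦ huv ⟨hTu hq, hball hd⟩⟩

/-- **A good tube** of the setup `S` along the arc `θ = θ₀`, of angular half-width `η` and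
radius `ε`: the annulus is framed on the thickened strip; on the strip over the annulus
`1 ≤ t ≤ 2` the tube is injective with injective derivative; points of the tube over the core
strip (half-width `η/4`) meet the annulus only in the zero section (`separated`, the other sheet
of the annulus being one period away); and over the open annulus the tube stays in the open
shell `1 < ‖y‖ < 2`. [folklore] -/
structure GoodTube (θ₀ η ε : ℝ) : Prop where
  η_pos : 0 < η
  η_le : η ≤ 1 / 4
  ε_pos : 0 < ε
  ε_le : ε ≤ 1
  frame : ∀ q ∈ Icc (θ₀ - η) (θ₀ + η) ×ˢ Icc (1 - S.δ / 2) (2 + S.δ / 2),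
    gramD S.F q ≠ 0 ∧ S.n₁ q ≠ 0
  injOn : InjOn S.tube ((Icc (θ₀ - η) (θ₀ + η) ×ˢ Icc (1 : ℝ) 2) ×ˢ ball (0 : ℝ × ℝ) ε)
  injective_fderiv : ∀ p ∈ (Icc (θ₀ - η) (θ₀ + η) ×ˢ Icc (1 : ℝ) 2) ×ˢ ball (0 : ℝ × ℝ) ε,
    Injective (fderiv ℝ S.tube p)
  separated : ∀ q ∈ Icc (θ₀ - η / 4) (θ₀ + η / 4) ×ˢ Icc (1 : ℝ) 2, ∀ d ∈ ball (0 : ℝ × ℝ) ε,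
    ∀ θ' t' : ℝ, t' ∈ Icc (1 : ℝ) 2 → S.tube (q, d) = S.F (θ', t') →
      d = 0 ∧ t' = q.2 ∧ ∃ m : ℤ, θ' = q.1 + m
  norm_mem : ∀ q ∈ Icc (θ₀ - η) (θ₀ + η) ×ˢ Ioo (1 : ℝ) 2, ∀ d ∈ ball (0 : ℝ × ℝ) ε,
    1 < ‖S.tube (q, d)‖ ∧ ‖S.tube (q, d)‖ < 2

end TubeSetup

end StripFrame

namespace Knot

namespace IsConicalConcordance

open StripFrame

/-! ### The annulus of a conical concordance along an arc -/

variable {K K' : Knot} {f : (𝕊 1) × ℝ → 𝔼 4} {δ : ℝ} (h : IsConicalConcordance K K' f δ)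
  (w : 𝔼 4)

/-- **The lifted annulus of a conical concordance is an immersion on the thickened annulus
`1 - δ/2 ≤ t ≤ 2 + δ/2`** (on `[1, 2]` by `Knot.IsConcordance`, on the cones because the cone
over an immersed circle is an immersion). [folklore] -/
theorem injective_fderiv_annulusLift (h : IsConicalConcordance K K' f δ) (θ : ℝ) {t : ℝ} (ht : t ∈ Icc (1 - δ / 2) (2 + δ / 2)) :
    Injective (fderiv ℝ (annulusLift f) (θ, t)) := by
  have hδ := h.δ_pos
  rcases lt_or_ge t 1 with h1 | h1
  · have e := (h.setup 0).fderiv_F_of_lt (q := (θ, t)) (by simp; linarith)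
    simp only [setup_F, setup_k₁] at e
    rw [e]
    exact injective_coneL (K.contDiff_curve.differentiable (by simp)) K.norm_curve
      K.deriv_curve_ne_zero (by simp; linarith [ht.1, h.δ_le])
  rcases lt_or_ge 2 t with h2 | h2
  · have e := (h.setup 0).fderiv_F_of_gt (q := (θ, t)) (by simp; linarith)
    simp only [setup_F, setup_k₂] at e
    rw [e]
    exact injective_coneL (K'.contDiff_curve.differentiable (by simp)) K'.norm_curve
      K'.deriv_curve_ne_zero (by simp; linarith)
  · exact h.isConcordance.injective_fderiv_annulusLift θ ⟨h1, h2⟩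

/-- **A framed strip**: for every arc `θ = θ₀` there are a general-position vector `w` and a
width `0 < η ≤ 1/4` such that on `[θ₀ - η, θ₀ + η] × [1 - δ/2, 2 + δ/2]` the lifted annulus is
an immersion and the first normal field of the setup does not vanish. [folklore] -/
theorem exists_framed_strip (θ₀ : ℝ) :
    ∃ (w : 𝔼 4) (η : ℝ), 0 < η ∧ η ≤ 1 / 4 ∧
      ∀ q ∈ Icc (θ₀ - η) (θ₀ + η) ×ˢ Icc (1 - δ / 2) (2 + δ / 2),
        gramD (h.setup w).F q ≠ 0 ∧ (h.setup w).n₁ q ≠ 0 := by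
  obtain ⟨w, η, hη, hgood⟩ := exists_frame_strip (F := annulusLift f)
    (contDiff_annulusLift h.isConcordance.1) θ₀ (a := 1 - δ / 2) (b := 2 + δ / 2)
    (fun t ht ↦ h.injective_fderiv_annulusLift θ₀ ht)
  refine ⟨w, min η (1 / 4), lt_min hη (by norm_num), min_le_right _ _, fun q hq ↦ ?_⟩
  exact hgood q ⟨⟨by linarith [hq.1.1, min_le_left η (1 / 4)],
    by linarith [hq.1.2, min_le_left η (1 / 4)]⟩, hq.2⟩

/-- **The lifted annulus is injective on a strip of width `< 1` over the annulus `1 ≤ t ≤ 2`**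
(the concordance is injective there and `circlePt` identifies parameters exactly modulo `ℤ`).
[folklore] -/
theorem injOn_F_strip {θ₀ η : ℝ} (hη : η < 1 / 2) :
    InjOn (h.setup w).F (Icc (θ₀ - η) (θ₀ + η) ×ˢ Icc (1 : ℝ) 2) := by
  rintro ⟨θ, t⟩ ⟨hθ, ht⟩ ⟨θ', t'⟩ ⟨hθ', ht'⟩ he
  simp only [setup_F, annulusLift_apply] at he
  have := h.isConcordance.2.1 ⟨mem_univ _, ht⟩ ⟨mem_univ _, ht'⟩ he
  simp only [Prod.mk.injEq] at this
  obtain ⟨hc, htt⟩ := this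
  obtain ⟨m, hm⟩ := circlePt_eq_circlePt_iff.1 hc
  have hm0 : m = 0 := by
    have h1 : |(m : ℝ)| < 1 := by
      rw [show (m : ℝ) = θ - θ' by linarith, abs_lt]
      constructor <;> linarith [hθ.1, hθ.2, hθ'.1, hθ'.2]
    have : |m| < 1 := by exact_mod_cast h1
    exact Int.abs_lt_one_iff.1 this
  subst hm0
  simp only [Int.cast_zero, add_zero] at hm
  rw [hm, htt]

/-- Two sheets of the lifted annulus one period apart are disjoint: if `F (θ, t) = F (θ', t')`
with `t, t' ∈ [1, 2]` then `θ' - θ ∈ ℤ`. [folklore] -/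
theorem exists_int_of_F_eq (h : IsConicalConcordance K K' f δ) {θ t θ' t' : ℝ}
    (ht : t ∈ Icc (1 : ℝ) 2) (ht' : t' ∈ Icc (1 : ℝ) 2)
    (he : annulusLift f (θ, t) = annulusLift f (θ', t')) : t = t' ∧ ∃ m : ℤ, θ' = θ + m := by
  simp only [annulusLift_apply] at he
  have := h.isConcordance.2.1 ⟨mem_univ _, ht⟩ ⟨mem_univ _, ht'⟩ he
  simp only [Prod.mk.injEq] at this
  obtain ⟨hc, htt⟩ := this
  obtain ⟨m, hm⟩ := circlePt_eq_circlePt_iff.1 hc.symm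
  exact ⟨htt, m, hm⟩

/-- The distance between two compact pieces of the lifted annulus is attained. [folklore] -/
theorem exists_isMinOn_dist (h : IsConicalConcordance K K' f δ) {A B : Set (ℝ × ℝ)}
    (hA : IsCompact A) (hB : IsCompact B) (hne : (A ×ˢ B).Nonempty) :
    ∃ p ∈ A ×ˢ B, IsMinOn (fun pq : (ℝ × ℝ) × (ℝ × ℝ) ↦
      dist (annulusLift f pq.1) (annulusLift f pq.2)) (A ×ˢ B) p := by
  have hc : Continuous fun pq : (ℝ × ℝ) × (ℝ × ℝ) ↦
      dist (annulusLift f pq.1) (annulusLift f pq.2) :=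
    ((contDiff_annulusLift h.isConcordance.1).continuous.comp continuous_fst).dist
      ((contDiff_annulusLift h.isConcordance.1).continuous.comp continuous_snd)
  exact (hA.prod hB).exists_isMinOn hne hc.continuousOn

/-- The norm of the lifted annulus attains its extrema on a compact set. [folklore] -/
theorem exists_isMinOn_isMaxOn_norm (h : IsConicalConcordance K K' f δ) {A : Set (ℝ × ℝ)}
    (hA : IsCompact A) (hne : A.Nonempty) :
    (∃ p ∈ A, IsMinOn (fun q ↦ ‖annulusLift f q‖) A p) ∧
      ∃ p ∈ A, IsMaxOn (fun q ↦ ‖annulusLift f q‖) A p := by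
  have hc : Continuous fun q ↦ ‖annulusLift f q‖ :=
    (contDiff_annulusLift h.isConcordance.1).continuous.norm
  exact ⟨hA.exists_isMinOn hne hc.continuousOn, hA.exists_isMaxOn hne hc.continuousOn⟩

/-- The core strip and the sheet of the annulus one period away are a positive distance apart.
[folklore] -/
theorem exists_sep_radius (h : IsConicalConcordance K K' f δ) {θ₀ η : ℝ} (hη : 0 < η)
    (hη4 : η ≤ 1 / 4) :
    ∃ ρ : ℝ, 0 < ρ ∧ ∀ q ∈ Icc (θ₀ - η / 4) (θ₀ + η / 4) ×ˢ Icc (1 : ℝ) 2,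
      ∀ q' ∈ Icc (θ₀ + η / 2) (θ₀ + 1 - η / 2) ×ˢ Icc (1 : ℝ) 2,
        ρ ≤ dist (annulusLift f q) (annulusLift f q') := by
  have hTc : IsCompact (Icc (θ₀ - η / 4) (θ₀ + η / 4) ×ˢ Icc (1 : ℝ) 2) :=
    isCompact_Icc.prod isCompact_Icc
  have hFc : IsCompact (Icc (θ₀ + η / 2) (θ₀ + 1 - η / 2) ×ˢ Icc (1 : ℝ) 2) :=
    isCompact_Icc.prod isCompact_Icc
  have hne : ∀ q ∈ Icc (θ₀ - η / 4) (θ₀ + η / 4) ×ˢ Icc (1 : ℝ) 2,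
      ∀ q' ∈ Icc (θ₀ + η / 2) (θ₀ + 1 - η / 2) ×ˢ Icc (1 : ℝ) 2,
      annulusLift f q ≠ annulusLift f q' := by
    rintro ⟨θ, t⟩ ⟨hθ, ht⟩ ⟨θ', t'⟩ ⟨hθ', ht'⟩ he
    obtain ⟨-, m, hm⟩ := h.exists_int_of_F_eq ht ht' he
    have h1 : (0 : ℝ) < m := by linarith [hθ.2, hθ'.1]
    have h2 : (m : ℝ) < 1 := by linarith [hθ.1, hθ'.2]
    have h1' : (0 : ℤ) < m := by exact_mod_cast h1
    have h2' : m < (1 : ℤ) := by exact_mod_cast h2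
    exact absurd h2' (not_lt.2 h1')
  have hq₀ : ((θ₀, 1) : ℝ × ℝ) ∈ Icc (θ₀ - η / 4) (θ₀ + η / 4) ×ˢ Icc (1 : ℝ) 2 :=
    mk_mem_prod ⟨by linarith, by linarith⟩ ⟨le_rfl, by norm_num⟩
  have hq₁ : ((θ₀ + 1 / 2, 1) : ℝ × ℝ) ∈ Icc (θ₀ + η / 2) (θ₀ + 1 - η / 2) ×ˢ Icc (1 : ℝ) 2 :=
    mk_mem_prod ⟨by linarith, by linarith⟩ ⟨le_rfl, by norm_num⟩
  obtain ⟨p₀, hp₀, hmin⟩ := h.exists_isMinOn_dist hTc hFc ⟨_, mk_mem_prod hq₀ hq₁⟩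
  refine ⟨dist (annulusLift f p₀.1) (annulusLift f p₀.2),
    dist_pos.2 (hne p₀.1 hp₀.1 p₀.2 hp₀.2), fun q hq q' hq' ↦ ?_⟩
  have hh := hmin (mk_mem_prod hq hq')
  simp only [mem_setOf_eq] at hh
  exact hh

/-- In the middle of the annulus the concordance stays a definite distance inside the open shell.
[folklore] -/
theorem exists_shell_margin (h : IsConicalConcordance K K' f δ) (θ₀ η : ℝ) :
    ∃ μ : ℝ, 0 < μ ∧ ∀ q ∈ Icc (θ₀ - η) (θ₀ + η) ×ˢ Icc (1 + δ / 4) (2 - δ / 4),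
      1 + μ ≤ ‖annulusLift f q‖ ∧ ‖annulusLift f q‖ ≤ 2 - μ := by
  have hδ := h.δ_pos
  have hδ4 := h.δ_le
  rcases lt_or_ge η 0 with hη | hη
  · refine ⟨1, one_pos, ?_⟩
    rintro q ⟨⟨h1, h2⟩, -⟩
    linarith
  have hTmc : IsCompact (Icc (θ₀ - η) (θ₀ + η) ×ˢ Icc (1 + δ / 4) (2 - δ / 4)) :=
    isCompact_Icc.prod isCompact_Icc
  have hTmne : (Icc (θ₀ - η) (θ₀ + η) ×ˢ Icc (1 + δ / 4) (2 - δ / 4)).Nonempty :=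
    ⟨(θ₀, 3 / 2), mk_mem_prod ⟨by linarith, by linarith⟩ ⟨by linarith, by linarith⟩⟩
  have hshell : ∀ q ∈ Icc (θ₀ - η) (θ₀ + η) ×ˢ Icc (1 + δ / 4) (2 - δ / 4),
      1 < ‖annulusLift f q‖ ∧ ‖annulusLift f q‖ < 2 := by
    rintro ⟨θ, t⟩ ⟨-, ht⟩
    exact h.isConcordance.2.2.2.1 (circlePt θ) t ⟨by linarith [ht.1], by linarith [ht.2]⟩
  obtain ⟨⟨qm, hqm, hqmin⟩, ⟨qM, hqM, hqmax⟩⟩ := h.exists_isMinOn_isMaxOn_norm hTmc hTmne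
  refine ⟨min (‖annulusLift f qm‖ - 1) (2 - ‖annulusLift f qM‖),
    lt_min (by linarith [(hshell qm hqm).1]) (by linarith [(hshell qM hqM).2]), fun q hq ↦ ?_⟩
  have hlo := hqmin hq
  have hhi := hqmax hq
  simp only [mem_setOf_eq] at hlo hhi
  constructor
  · linarith [min_le_left (‖annulusLift f qm‖ - 1) (2 - ‖annulusLift f qM‖)]
  · linarith [min_le_right (‖annulusLift f qm‖ - 1) (2 - ‖annulusLift f qM‖)]

/-- **Every conical concordance has a good tube along every arc.** [folklore] -/
theorem exists_goodTube (h : IsConicalConcordance K K' f δ) (θ₀ : ℝ) :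
    ∃ (w : 𝔼 4) (η ε : ℝ), (h.setup w).GoodTube θ₀ η ε := by
  have hδ := h.δ_pos
  have hδ4 := h.δ_le
  obtain ⟨w, η, hη, hη4, hframe⟩ := h.exists_framed_strip θ₀
  -- the strip over the annulus
  have hTc : IsCompact (Icc (θ₀ - η) (θ₀ + η) ×ˢ Icc (1 : ℝ) 2) := isCompact_Icc.prod isCompact_Icc
  obtain ⟨ε₀, hε₀, hinj, himm⟩ := (h.setup w).exists_injOn_tube hTc
    (fun q hq ↦ by linarith [hq.2.1])
    (fun q hq ↦ hframe q ⟨hq.1, ⟨by linarith [hq.2.1], by linarith [hq.2.2]⟩⟩)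
    (h.injOn_F_strip w (by linarith))
  obtain ⟨ρ, hρ, hρle⟩ := h.exists_sep_radius (θ₀ := θ₀) hη hη4
  obtain ⟨ε₁, hε₁, hclose₁⟩ := (h.setup w).exists_forall_dist_tube_lt hTc hρ
  obtain ⟨μ, hμ, hmargin⟩ := h.exists_shell_margin θ₀ η
  obtain ⟨ε₂, hε₂, hclose₂⟩ := (h.setup w).exists_forall_dist_tube_lt hTc hμ
  -- the radius
  set ε : ℝ := min (min ε₀ ε₁) (min ε₂ 1) with hε
  have hεpos : 0 < ε := lt_min (lt_min hε₀ hε₁) (lt_min hε₂ one_pos)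
  have hε₀' : ε ≤ ε₀ := (min_le_left _ _).trans (min_le_left _ _)
  have hε₁' : ε ≤ ε₁ := (min_le_left _ _).trans (min_le_right _ _)
  have hε₂' : ε ≤ ε₂ := (min_le_right _ _).trans (min_le_left _ _)
  have hb₀ : ball (0 : ℝ × ℝ) ε ⊆ ball 0 ε₀ := ball_subset_ball hε₀'
  have hb₁ : ball (0 : ℝ × ℝ) ε ⊆ ball 0 ε₁ := ball_subset_ball hε₁'
  have hb₂ : ball (0 : ℝ × ℝ) ε ⊆ ball 0 ε₂ := ball_subset_ball hε₂'
  have hT₀T : Icc (θ₀ - η / 4) (θ₀ + η / 4) ×ˢ Icc (1 : ℝ) 2 ⊆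
      Icc (θ₀ - η) (θ₀ + η) ×ˢ Icc (1 : ℝ) 2 :=
    fun q hq ↦ ⟨⟨by linarith [hq.1.1], by linarith [hq.1.2]⟩, hq.2⟩
  refine ⟨w, η, ε, ?_⟩
  refine
    { η_pos := hη
      η_le := hη4
      ε_pos := hεpos
      ε_le := (min_le_right _ _).trans (min_le_right _ _)
      frame := hframe
      injOn := fun p hp p' hp' he ↦ hinj ⟨hp.1, hb₀ hp.2⟩ ⟨hp'.1, hb₀ hp'.2⟩ he
      injective_fderiv := fun p hp ↦ himm p ⟨hp.1, hb₀ hp.2⟩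
      separated := ?_
      norm_mem := ?_ }
  · -- separation
    rintro ⟨θq, tq⟩ hq d hd θ' t' ht' he
    -- reduce `θ'` modulo the period into `[θ₀ - η/2, θ₀ + 1 - η/2)`
    obtain ⟨m, hlo, hhi⟩ : ∃ m : ℤ, θ₀ - η / 2 ≤ θ' - m ∧ θ' - m < θ₀ + 1 - η / 2 := by
      refine ⟨⌊θ' - (θ₀ - η / 2)⌋, ?_, ?_⟩
      · have := Int.floor_le (θ' - (θ₀ - η / 2))
        linarith
      · have := Int.lt_floor_add_one (θ' - (θ₀ - η / 2))
        linarith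
    have hper : (h.setup w).F (θ' - m, t') = (h.setup w).F (θ', t') := by
      show annulusLift f (θ' - m, t') = annulusLift f (θ', t')
      rw [← annulusLift_add_int f (θ' - m) t' m, sub_add_cancel]
    rw [← hper] at he
    rcases le_or_gt (θ' - m) (θ₀ + η / 2) with hcase | hcase
    · -- the near sheet: injectivity of the tube
      have hmemT : ((θ' - m, t') : ℝ × ℝ) ∈ Icc (θ₀ - η) (θ₀ + η) ×ˢ Icc (1 : ℝ) 2 :=
        ⟨⟨by linarith, by linarith⟩, ht'⟩
      have hz : (h.setup w).tube ((θ' - m, t'), 0) = (h.setup w).tube ((θq, tq), d) := by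
        rw [(h.setup w).tube_zero, he]
      have := hinj ⟨hmemT, mem_ball_self hε₀⟩ ⟨hT₀T hq, hb₀ hd⟩ hz
      simp only [Prod.mk.injEq] at this
      obtain ⟨⟨hθq, htq⟩, hd0⟩ := this
      exact ⟨hd0.symm, htq, m, by simp only; linarith⟩
    · -- the far sheet: too far away
      exfalso
      have hmemF : ((θ' - m, t') : ℝ × ℝ) ∈ Icc (θ₀ + η / 2) (θ₀ + 1 - η / 2) ×ˢ Icc (1 : ℝ) 2 :=
        ⟨⟨hcase.le, by linarith⟩, ht'⟩
      have h1 := hρle (θq, tq) hq (θ' - m, t') hmemF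
      have h2 := hclose₁ (θq, tq) (hT₀T hq) d (hb₁ hd)
      rw [he, dist_comm] at h2
      exact absurd h1 (not_le.2 h2)
  · -- the open shell
    rintro ⟨θ, t⟩ ⟨hθ, ht⟩ d hd
    rcases le_or_gt t (1 + δ / 4) with h1 | h1
    · rw [(h.setup w).norm_tube_of_le (show t ≤ 1 + (h.setup w).δ / 4 from h1),
        abs_of_pos (by linarith [ht.1])]
      exact ⟨ht.1, by linarith⟩
    rcases le_or_gt (2 - δ / 4) t with h2 | h2
    · rw [(h.setup w).norm_tube_of_ge (show 2 - (h.setup w).δ / 4 ≤ t from h2),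
        abs_of_pos (by linarith [ht.1])]
      exact ⟨by linarith, ht.2⟩
    · have hmem : ((θ, t) : ℝ × ℝ) ∈ Icc (θ₀ - η) (θ₀ + η) ×ˢ Icc (1 + δ / 4) (2 - δ / 4) :=
        ⟨hθ, ⟨h1.le, h2.le⟩⟩
      have hmT : ((θ, t) : ℝ × ℝ) ∈ Icc (θ₀ - η) (θ₀ + η) ×ˢ Icc (1 : ℝ) 2 :=
        ⟨hθ, ⟨ht.1.le, ht.2.le⟩⟩
      have hd' := hclose₂ (θ, t) hmT d (hb₂ hd)
      rw [dist_eq_norm] at hd'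
      obtain ⟨hlo, hhi⟩ := hmargin (θ, t) hmem
      have hlo' : 1 + μ ≤ ‖(h.setup w).F (θ, t)‖ := hlo
      have hhi' : ‖(h.setup w).F (θ, t)‖ ≤ 2 - μ := hhi
      constructor
      · have := norm_sub_norm_le ((h.setup w).F (θ, t)) ((h.setup w).tube ((θ, t), d))
        rw [norm_sub_rev] at this
        linarith
      · have := norm_sub_norm_le ((h.setup w).tube ((θ, t), d)) ((h.setup w).F (θ, t))
        linarith

end IsConicalConcordance

end Knot

end Literature.Topology.FourManifolds
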